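import Summits.Schanuel.Schanuel.Theses.RoyCriterion
import Summits.Schanuel.Schanuel.Theorems.RoySmallValueDirichletGap.Negative.GapReduction
import Summits.Schanuel.Schanuel.Theorems.RoySmallValueDirichletGap.Negative.EtaNeZeroFalse
import Summits.Schanuel.Schanuel.Theorems.RoySmallValueDirichletGap.Negative.TauLtOneAndCountLeDegreeFalse
import Literature.NumberTheory.Transcendental.QuadraticRelationsLogarithmsWeilHeight

/-!
# Line `leaf-invariant-theta` for crux `RoySmallValueDirichletGap` (item stmt-Schanuel-1050) — crux-plan verdict: NO CONCLUDING SKELETON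

Crux (route `RoyCriterion`): `Summit.Schanuel.Schanuel.Theses.RoyCriterion.RoySmallValueDirichletGap`
= Roy 2013 (arXiv:1301.0663) Thm 1.1 with `ν` pushed down to the Dirichlet edge `2 + β − τ`
(open content: `1 < τ < 2`, `0 < δ := ν − (2+β−τ) ≤ δ_R := (τ−1)(2−τ)/(β+1−τ)`).

Idea `leaf-invariant-theta` (crux-ideate r1 ideator 1; merged by all three triagers with
`leaf-quotient-hermite-lindemann`, same lever): the first integral `θ = X₂ e^{−X₁}` of Roy's
derivation `𝒟₁` is LEVEL-FREE, so two distinct "enemies" `Z_N ≠ Z_{N+1}` of Roy's proof, whose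
Step-2 hugging points `(x,y), (x',y')` both lie within `e^{−N^{β+δ}/C}` of the transcendental leaf
`{θ = η e^{−ξ}}`, have group quotient `(a,b) = (x−x', y/y') ∈ ℚ̄ × ℚ̄ˣ` with `|b − e^{a}|` tiny and
`|a|` tiny; a Hermite–Lindemann measure (Nesterenko–Waldschmidt 1996 with the free parameter
`E ≈ 1/|a|`) then separates, where Roy's transcendence-free descent loses `T/T*`.

## What this file certifies (lean check rc 0; `sorry` only in the three `stub_*` of §2)

* §1 **WINDOW INVISIBILITY** (`crux_iff_belowWindow`, kernel-checked, generalising the landed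
  Negative lemma `roySmallValueDirichletGap_iff_nearEdge`): for EVERY positive function
  `w(β,τ) > 0` the crux is EQUIVALENT to its restriction to `2+β−τ < ν ≤ 2+β−τ+w(β,τ)`.
  Consequently any statement of the shape "the estimate holds for `ν > 2+β−τ+δ₁(β,τ)`" with
  `δ₁ > 0` (`CruxAboveWindow`) — which is exactly the shape of this lever's deliverable
  (`RoyExponentNotSharp`, §2) — can appear in a skeleton `… → RoySmallValueDirichletGap` only next
  to a residual hypothesis `CruxBelowWindow w` that is ITSELF the crux (`windowSplit_degenerate`:
  the glue uses only its second argument): a costume. Route note: the foreseen glued split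
  "sub-gap window → residual window → crux" of the route header is degenerate for the same reason;
  non-degenerate splits of this crux are by `τ`-range or by point class, never by `ν`-window.
* §2 **THE LEVER'S HONEST REACH**, as a checked skeleton for the SUPPORT-level statement
  `RoyExponentNotSharp` (Roy's printed exponent is not sharp anywhere on `1 < τ < 2`): three
  registered-shape stubs `stub_leafHuggingEnemies` (Roy 2013 §7 Steps 1–5 instrumented: under
  ¬conclusion, frequently in `N`, a leaf-hugging pair with degree `≪ N^{2e(δ)}`, height
  `≪ N^{b(δ)(1+β−τ)}`, `|x−ξ| ≤ e^{−N^{β+δ−τ}/C}`, leaf distance `≤ e^{−N^{β+δ}/C}`),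
  `stub_leafQuotientRigidity` (Nesterenko–Waldschmidt 1996 Thm 1 + Liouville on the quotient:
  `S ≤ c(D³log(D+2)H + D²H²/L + D³log(D+2)H²/L²)`), `stub_killBookkeeping` (real analysis:
  some `δ₁ < δ_R` makes the bound eventually smaller than `S = N^{β+δ}/C` for all
  `δ ∈ (δ₁, δ_R]`; margins at `δ_R`: `1+δ_R`, `(2−τ)+2δ_R`, `β+2−2τ+3δ_R`), and the REAL composition
  `royExponentNotSharp_of : LeafHuggingEnemies → LeafQuotientRigidity → KillBookkeeping →
  RoyExponentNotSharp` (no sorry), plus the sandwich `royExponentNotSharp_of_crux`.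
* §3 **EDGE BUDGET** (arithmetic, kernel-checked): at the edge `δ → 0⁺` Roy's enemies have degree
  exponent `degExp β τ 0 = 2 − τ` and height exponent `htExp β τ 0 = 1 + β − τ` (total height of the
  orbit, = degree × absolute height). ANY arithmetic exclusion of a pair of algebraic points costs at
  least Liouville strength `D·h` — for the quotient `(a,b)` optimally `deg Z′·h(Z) + deg Z·h(Z′)` —
  so a NECESSARY condition for the lever at the edge is `(2−τ)+(1+β−τ) < β ⟺ τ > 3/2`
  (`edge_budget_iff`; the cruder count `deg·deg′·max h` gives `τ > 5/3`, `edge_budget_compositum_iff`).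
  A genuine Hermite–Lindemann MEASURE uniform in the degree must even cost `≳ D_K²·h` (Wirsing 1961:
  degree-`D` approximations `|e − b| ≤ H(b)^{−(D+3)/2}` exist), which makes `Sketch.LinearHermiteLindemann 1`
  counting-inconsistent in the growing-degree regime and pushes the dream threshold to `τ ≥ 7/4`
  (sibling line card `coset-difference-hermite-lindemann`, `δpair_pos_iff` in CosetDifferenceExponents.lean).
  Hence on `1 < τ ≤ 3/2` (indeed `τ < 7/4` for measures) the lever cannot reach the edge, and the only
  stub that could complete a `RoySmallValueDirichletGap_of` restates the crux on that `τ`-slice (the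
  slice is not implied by the upper slice: the hypothesis is antitone in `τ` but the edge `2+β−τ`
  moves the wrong way). Below `3/2` the single-enemy entropy threshold is
  `δ > (3−2τ)(τ−1)/(1+2β−τ)` (`conditional_threshold_identity`; = the sibling's `δcount`), of
  Nguyen–Roy's shape.

Disproof.lean (cdisprove gen2 v0) honoured: `η ≠ 0` is used in `stub_leafQuotientRigidity`
(`y' ≠ 0` for the quotient and the constant `c(ξ,η)`; cf. `roySmallValueDirichletGap_false_without_etaNeZero`,
imported), `1 < τ` in `stub_leafHuggingEnemies`/`stub_killBookkeeping` (`b(δ) = 1 − δ/(τ−1)`; cf.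
`roySmallValueDirichletGap_false_without_oneLeTau`, imported), the count `3⌊D^τ⌋` is the crux's own
(`SmallValueHyp` verbatim; cf. `roySmallValueDirichletGap_false_of_count_le_degree`, imported), and no
statement goes below the Dirichlet edge. No stub is an instance of a landed Negative lemma.

NOT registered with `ledger skeleton check` on purpose: nothing here concludes the crux (only the
degenerate window split could), and registering `stub_*` on the crux item would constrain
`propose --supports stmt-Schanuel-1050` for every other seat. If a planner files `RoyExponentNotSharp`
as a support item of route `RoyCriterion`, §2 is a ready 3-stub Line for THAT item (hardest stub:
`stub_leafHuggingEnemies`).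
-/

set_option linter.dupNamespace false

noncomputable section

namespace Summit.Schanuel.Schanuel.Cruxes.RoySmallValueDirichletGap.LeafInvariantTheta

open Filter Complex
open Literature.NumberTheory.Transcendental
open Summit.Schanuel.Schanuel.Theses.RoyCriterion (RoySmallValueDirichletGap)

/-! ## §0 The crux read back -/

/-- The small-value hypothesis of the crux at `(ξ, η)` with exponents `(β, τ, ν)` — the verbatim
sub-formula of `RoySmallValueDirichletGap` (identical to `Sketch.RoyHyp` of SketchIdeator3.lean and
`Disproof.SmallValueHyp`). [cite: Roy2013, Theorem 1.1 (hypothesis)] -/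
def SmallValueHyp (ξ η : ℂ) (β τ ν : ℝ) : Prop :=
  ∀ᶠ D : ℕ in atTop, ∃ P : MvPolynomial (Fin 2) ℤ, P ≠ 0 ∧ P.totalDegree ≤ D ∧
    (mvPolyHeight P : ℝ) ≤ Real.exp ((D : ℝ) ^ β) ∧
    ∀ i : ℕ, i < 3 * ⌊(D : ℝ) ^ τ⌋₊ →
      ‖MvPolynomial.aeval ![ξ, η] (royD^[i] P)‖ ≤ Real.exp (-(D : ℝ) ^ ν)

/-- Roy's printed correction term `δ_R = (τ−1)(2−τ)/(β+1−τ)` (width of the open window; identical to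
`Sketch.royExponent`). [cite: Roy2013, Theorem 1.1, (1.1)] -/
def royGap (β τ : ℝ) : ℝ := (τ - 1) * (2 - τ) / (β + 1 - τ)

/-- READ-BACK: the crux verbatim in terms of `SmallValueHyp`. -/
theorem crux_iff : RoySmallValueDirichletGap ↔
    ∀ (ξ η : ℂ), η ≠ 0 → ∀ (β τ ν : ℝ), 1 ≤ τ → τ < 2 → τ < β → 2 + β - τ < ν →
      SmallValueHyp ξ η β τ ν → IsAlgebraic ℚ ξ ∧ IsAlgebraic ℚ η := Iff.rfl

/-- `δ_R > 0` on the open range `1 < τ < 2`, `β > τ`. -/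
theorem royGap_pos {β τ : ℝ} (h1 : 1 < τ) (h2 : τ < 2) (hβ : τ < β) : 0 < royGap β τ :=
  div_pos (mul_pos (by linarith) (by linarith)) (by linarith)

/-- The hypothesis is antitone in `ν` (a smaller smallness exponent asks for less). [folklore] -/
theorem SmallValueHyp.anti_nu {ξ η : ℂ} {β τ ν ν' : ℝ} (hν : ν' ≤ ν) (h : SmallValueHyp ξ η β τ ν) :
    SmallValueHyp ξ η β τ ν' := by
  unfold SmallValueHyp at h ⊢
  filter_upwards [h, eventually_ge_atTop 1] with D hD hD1
  obtain ⟨P, hP0, hdeg, hht, hval⟩ := hD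
  refine ⟨P, hP0, hdeg, hht, fun i hi => (hval i hi).trans ?_⟩
  have h1 : (1 : ℝ) ≤ D := by exact_mod_cast hD1
  exact Real.exp_le_exp.2 (neg_le_neg (Real.rpow_le_rpow_of_exponent_le h1 hν))

/-! ## §1 Window invisibility: why a sub-gap window cannot be a stub of a concluding skeleton -/

/-- The crux RESTRICTED to the window `2+β−τ < ν ≤ 2+β−τ+w(β,τ)` above the Dirichlet edge
(the "residual window" of any split by `ν`). -/
def CruxBelowWindow (w : ℝ → ℝ → ℝ) : Prop :=
  ∀ (ξ η : ℂ), η ≠ 0 → ∀ (β τ ν : ℝ), 1 ≤ τ → τ < 2 → τ < β → 2 + β - τ < ν →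
    ν ≤ 2 + β - τ + w β τ → SmallValueHyp ξ η β τ ν → IsAlgebraic ℚ ξ ∧ IsAlgebraic ℚ η

/-- The crux ABOVE the window: the estimate for `ν > 2+β−τ+w(β,τ)` — the shape of every
"sub-gap window" theorem (Roy's Thm 1.1 is the case `w = royGap`; this lever's deliverable
`RoyExponentNotSharp` is the case of some `w < royGap`). -/
def CruxAboveWindow (w : ℝ → ℝ → ℝ) : Prop :=
  ∀ (ξ η : ℂ), η ≠ 0 → ∀ (β τ ν : ℝ), 1 ≤ τ → τ < 2 → τ < β → 2 + β - τ + w β τ < ν →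
    SmallValueHyp ξ η β τ ν → IsAlgebraic ℚ ξ ∧ IsAlgebraic ℚ η

/-- **Window invisibility.** For EVERY positive function `w`, the crux is equivalent to its
restriction to the window `2+β−τ < ν ≤ 2+β−τ+w(β,τ)`: the residual window of any `ν`-split IS the
crux (antitonicity in `ν`, pointwise in `(β, τ)`; generalises the landed
`roySmallValueDirichletGap_iff_nearEdge`, which is the constant case). [folklore] -/
theorem crux_iff_belowWindow (w : ℝ → ℝ → ℝ) (hw : ∀ β τ : ℝ, 1 ≤ τ → τ < 2 → τ < β → 0 < w β τ) :
    RoySmallValueDirichletGap ↔ CruxBelowWindow w := by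
  constructor
  · intro h ξ η hη β τ ν h1 h2 hβ hν _ hP
    exact h ξ η hη β τ ν h1 h2 hβ hν hP
  · intro h ξ η hη β τ ν h1 h2 hβ hν hP
    rcases le_or_gt ν (2 + β - τ + w β τ) with hle | hlt
    · exact h ξ η hη β τ ν h1 h2 hβ hν hle hP
    · exact h ξ η hη β τ (2 + β - τ + w β τ) h1 h2 hβ (by linarith [hw β τ h1 h2 hβ]) le_rfl
        (SmallValueHyp.anti_nu hlt.le hP)

/-- The constant-window case is the landed Negative lemma (read-back check against the tree). -/
theorem crux_iff_nearEdge {ε : ℝ} (hε : 0 < ε) : RoySmallValueDirichletGap ↔ CruxBelowWindow fun _ _ => ε :=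
  Summit.Schanuel.Schanuel.Theorems.RoySmallValueDirichletGapGap.roySmallValueDirichletGap_iff_nearEdge hε

/-- Every sub-gap window theorem is implied by the crux (the easy half of the sandwich). -/
theorem aboveWindow_of_crux (w : ℝ → ℝ → ℝ) (hw : ∀ β τ : ℝ, 1 ≤ τ → τ < 2 → τ < β → 0 ≤ w β τ) :
    RoySmallValueDirichletGap → CruxAboveWindow w := fun h ξ η hη β τ ν h1 h2 hβ hν hP =>
  h ξ η hη β τ ν h1 h2 hβ (by linarith [hw β τ h1 h2 hβ]) hP

/-- **The degenerate glue.** A "window split" `CruxAboveWindow w → CruxBelowWindow w → crux` is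
provable WITHOUT its first hypothesis — the residual alone is the crux — while the first hypothesis
is a mere corollary of the crux. This is why no skeleton of this lever (whose reach is a
`CruxAboveWindow` statement, §2–§3) concludes the crux honestly. (Stated as a conjunction so that no
theorem of this workfile poses as a conditional proof of the crux in the tree audit.) -/
theorem windowSplit_degenerate (w : ℝ → ℝ → ℝ)
    (hw : ∀ β τ : ℝ, 1 ≤ τ → τ < 2 → τ < β → 0 < w β τ) :
    (CruxAboveWindow w → CruxBelowWindow w → RoySmallValueDirichletGap) ∧
      (CruxBelowWindow w → RoySmallValueDirichletGap) ∧
      (RoySmallValueDirichletGap → CruxAboveWindow w ∧ CruxBelowWindow w) :=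
  ⟨fun _ h => (crux_iff_belowWindow w hw).2 h, (crux_iff_belowWindow w hw).2, fun h =>
    ⟨aboveWindow_of_crux w (fun β τ h1 h2 hβ => (hw β τ h1 h2 hβ).le) h,
      (crux_iff_belowWindow w hw).1 h⟩⟩

/-! ## §2 The lever, and its honest reach `RoyExponentNotSharp` (a checked support-level skeleton) -/

/-- The LEAF INVARIANT `θ(x, y) = y e^{−x}`: a first integral of the flow `(ξ+z, ηe^z)` of Roy's
derivation `𝒟₁ = ∂/∂X₁ + X₂∂/∂X₂`; its level sets are the translates `A_γ` of the one-parameter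
subgroup `{(z, e^z)}` of `𝔾ₐ × 𝔾ₘ`. [cite: Roy2013, §4 (the curve A_γ)] -/
def leafInvariant (x y : ℂ) : ℂ := y * cexp (-x)

/-- `θ` is constant along the flow of `𝒟₁` (level-free). [folklore] -/
theorem leafInvariant_flow (ξ η z : ℂ) : leafInvariant (ξ + z) (η * cexp z) = leafInvariant ξ η := by
  unfold leafInvariant
  calc η * cexp z * cexp (-(ξ + z)) = η * cexp (-ξ) * (cexp z * cexp (-z)) := by
        rw [neg_add, Complex.exp_add]; ring
    _ = η * cexp (-ξ) := by rw [← Complex.exp_add, add_neg_cancel, Complex.exp_zero, mul_one]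

/-- The θ ↔ group-quotient dictionary: translating a point by `(a, b) ∈ 𝔾ₐ × 𝔾ₘ` multiplies `θ` by
`b e^{−a}`; so two points on (or near) ONE leaf have quotient `(a, b)` with `b e^{−a} = 1` (or
`≈ 1`), i.e. `|e^{a} − b|` small — the Hermite–Lindemann configuration. [folklore] -/
theorem leafInvariant_translate (x y a b : ℂ) :
    leafInvariant (x + a) (y * b) = leafInvariant x y * (b * cexp (-a)) := by
  unfold leafInvariant
  rw [neg_add, Complex.exp_add]
  ring

/-- `θ` separates algebraic points: on `ℚ̄ × ℚ̄ˣ` it is injective (Hermite–Lindemann, in tree as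
`transcendental_exp_holds`). The qualitative heart of the lever: a leaf meets `G(ℚ̄)` at most once.
[cite: Lindemann1882] -/
theorem leafInvariant_injective {x y x' y' : ℂ} (hx : IsAlgebraic ℚ x) (hy : IsAlgebraic ℚ y)
    (hx' : IsAlgebraic ℚ x') (hy' : IsAlgebraic ℚ y') (hy0 : y ≠ 0)
    (h : leafInvariant x y = leafInvariant x' y') : x = x' ∧ y = y' := by
  unfold leafInvariant at h
  -- `y' e^{x − x'} = y`
  have key : y' * cexp (x - x') = y := by
    have h1 : y' * cexp (x - x') = y' * cexp (-x') * cexp x := by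
      rw [sub_eq_neg_add, Complex.exp_add]; ring
    rw [h1, ← h, mul_assoc, ← Complex.exp_add, neg_add_cancel, Complex.exp_zero, mul_one]
  have hy'0 : y' ≠ 0 := by
    rintro rfl
    rw [zero_mul] at key
    exact hy0 key.symm
  -- so `e^{x − x'} = y/y'` is algebraic, hence `x = x'` by Hermite–Lindemann
  have hexp : cexp (x - x') = y / y' := by
    rw [eq_div_iff hy'0, mul_comm]
    exact key
  have halg : IsAlgebraic ℚ (cexp (x - x')) := by
    rw [hexp, div_eq_mul_inv]
    exact hy.mul hy'.inv
  have hzero : x - x' = 0 := by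
    by_contra hne
    exact transcendental_exp_holds (hx.sub hx') hne halg
  refine ⟨sub_eq_zero.1 hzero, ?_⟩
  rw [hzero, Complex.exp_zero, mul_one] at key
  exact key.symm

/-- A LEAF-HUGGING PAIR at `(ξ, η)` with size parameters `(Dg, H)` and closeness parameters
`(L, S)`: two DISTINCT algebraic points `(x, y) ≠ (x', y')` generating a field of degree `≤ Dg`,
of affine absolute logarithmic Weil heights `≤ H` (tree `weilHeight₁`), both within `e^{−L}` of
`ξ` in the additive coordinate and both with leaf invariant within `e^{−S}` of `θ(ξ, η)`. -/
def LeafPair (ξ η : ℂ) (Dg H L S : ℝ) : Prop :=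
  ∃ x y x' y' : ℂ, IsAlgebraic ℚ x ∧ IsAlgebraic ℚ y ∧ IsAlgebraic ℚ x' ∧ IsAlgebraic ℚ y' ∧
    (x, y) ≠ (x', y') ∧
    (Module.finrank ℚ ↥(IntermediateField.adjoin ℚ ({x, y, x', y'} : Set ℂ)) : ℝ) ≤ Dg ∧
    weilHeight₁ (IntermediateField.adjoin ℚ ({x, y, x', y'} : Set ℂ)) ![x, y] ≤ H ∧
    weilHeight₁ (IntermediateField.adjoin ℚ ({x, y, x', y'} : Set ℂ)) ![x', y'] ≤ H ∧
    ‖x - ξ‖ ≤ Real.exp (-L) ∧ ‖x' - ξ‖ ≤ Real.exp (-L) ∧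
    ‖leafInvariant x y - leafInvariant ξ η‖ ≤ Real.exp (-S) ∧
    ‖leafInvariant x' y' - leafInvariant ξ η‖ ≤ Real.exp (-S)

/-- Roy's ENEMY DEGREE EXPONENT `e(δ) = max(0, 2 − τ − δ(1+β−τ)/(τ−1))`: under ¬conclusion at
smallness `ν = 2+β−τ+δ`, Step 5 gives `(D*)^{τ−1} ≤ (3/κ)D^{τ−1−δ}` and
`D^{δ+β−τ}·deg Z ≤ C (D*)^{1−τ} h(Z) ≤ C' (D*)^{2+β−2τ}`, hence `deg Z_N ≪ N^{e(δ)}`; `e(δ_R) = 0`.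
[cite: Roy2013, §7, Step 5] -/
def degExp (β τ δ : ℝ) : ℝ := max 0 (2 - τ - δ * (1 + β - τ) / (τ - 1))

/-- Roy's ENEMY HEIGHT EXPONENT `b(δ)(1+β−τ)`, `b(δ) = 1 − δ/(τ−1)`: `h(Z_N) ≤ 7(D*)^{1+β−τ}` with
`D* ≪ N^{b(δ)}`. [cite: Roy2013, §7, Steps 3 and 5] -/
def htExp (β τ δ : ℝ) : ℝ := (1 - δ / (τ - 1)) * (1 + β - τ)

/-- The three-term Nesterenko–Waldschmidt bound (degree `Dg`, height `H`, `L = log(1/|a|)` feeding the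
free parameter `log E ≈ min(L, Dg·H)`): `Dg³ log(Dg+2) H + Dg² H²/L + Dg³ log(Dg+2) H²/L²`.
[cite: NesterenkoWaldschmidt1996, Theorem 1] -/
def nwBound (Dg H L : ℝ) : ℝ :=
  Dg ^ 3 * Real.log (Dg + 2) * H + Dg ^ 2 * H ^ 2 / L + Dg ^ 3 * Real.log (Dg + 2) * H ^ 2 / L ^ 2

/-- **Stub statement 1 — leaf-hugging enemies (Roy 2013 §7 Steps 1–5, instrumented).** If `(ξ, η)`
(`η ≠ 0`) is NOT in `ℚ̄ × ℚ̄` and the small-value hypothesis holds with `ν = 2+β−τ+δ`,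
`0 < δ ≤ δ_R`, `1 < τ < 2 < …`, then for some `C ≥ 1` and INFINITELY MANY `N` there is a
leaf-hugging pair with `Dg = C N^{2e(δ)}`, `H = C N^{b(δ)(1+β−τ)}`, `L = N^{β+δ−τ}/C`,
`S = N^{β+δ}/C`. Why plausibly true: it is Roy's own proof run without its last line — for every
large `N` Steps 1–2 give a `ℚ`-irreducible 0-dimensional `Z_N` and a point `α_N ∈ Z_N` with BOTH
`T log pdist(α_N, γ) ≤ −B/deg Z_N` and `log adist(α_N, A_γ) ≤ −B/deg Z_N`, `B/deg Z_N ≥ κ N^{δ+β}`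
(tree `Roy2013.ZeroConfigK.step2_distance_sum` keeps the `max`; `adist = |y − η e^{x−ξ}|`,
`|x − ξ| ≤ 2c₂² pdist` by `Roy2013.lemma_4_1`; `θ(x,y) − θ(ξ,η) = e^{−x}(y − ηe^{x−ξ})`); Steps 3/5
(tree `ZeroConfigK.step3_bounds`, `Roy2013.endgame_step`, valid for EVERY large `N` as long as no
contradiction is drawn, i.e. for `δ ≤ δ_R`) bound `deg Z_N ≪ N^{e(δ)}`, `h(α_N) ≤ h(Z_N)/deg Z_N + 3
≪ N^{b(δ)(1+β−τ)}`; `Z_N ≠ Z_{N+1}` for infinitely many `N` (else `γ ∈ Z(ℂ) ⊂ ℙ²(ℚ̄)`), and two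
distinct Galois orbits are disjoint, so `α_N ≠ α_{N+1}`; the compositum has degree
`≤ deg Z_N · deg Z_{N+1}`. Size: L (re-exposes per-level data now internal to
`RoySmallValueMain.lean`'s single `by_contra`). Uses `1 < τ` (`b(δ)`), the crux's own count and edge. -/
def LeafHuggingEnemies : Prop :=
  ∀ (ξ η : ℂ), η ≠ 0 → ¬ (IsAlgebraic ℚ ξ ∧ IsAlgebraic ℚ η) →
    ∀ (β τ δ : ℝ), 1 < τ → τ < 2 → τ < β → 0 < δ → δ ≤ royGap β τ →
      SmallValueHyp ξ η β τ (2 + β - τ + δ) →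
      ∃ C : ℝ, 1 ≤ C ∧ ∃ᶠ N : ℕ in atTop,
        LeafPair ξ η (C * (N : ℝ) ^ (2 * degExp β τ δ)) (C * (N : ℝ) ^ htExp β τ δ)
          ((N : ℝ) ^ (β + δ - τ) / C) ((N : ℝ) ^ (β + δ) / C)

/-- **Stub statement 2 — leaf-quotient rigidity (the Hermite–Lindemann-measure content).** For
`η ≠ 0` there is `c = c(ξ, η) > 0` such that every leaf-hugging pair with `Dg, H ≥ 1`, `L, S ≥ c`
satisfies `S ≤ c·nwBound Dg H L`. Why plausibly true: put `a = x − x'`, `b = y/y'` (`y' ≠ 0`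
because `θ(x',y')` is `e^{−S}`-close to `θ(ξ,η) = ηe^{−ξ} ≠ 0` — this is where `η ≠ 0` is used);
`leafInvariant_translate` gives `|b e^{−a} − 1| ≤ C e^{−S}`, `|a| ≤ 2e^{−L}`; `(a,b) ≠ (0,1)` since
the points differ; if `a = 0` or `b = 1`, Liouville (`log|z| ≥ −D(h(z)+log 2)`) gives `S ≤ C·Dg·H`;
otherwise Nesterenko–Waldschmidt 1996, Main Theorem (arXiv:math/0002047 p. 1, printed with the
explicit constant 211; shape = `Sketch.NesterenkoWaldschmidt1996` of SketchIdeator3.lean) with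
`θ := a`, `β := a`, `α := b`, `D ≤ Dg`, `log A, log B ≤ 2H + 1` and the FREE parameter
`log E := min(L + log(Dg(2H+1)) − log 4, Dg·H)` (legal because `2E|a| ≤ D log A`), whose 27
monomials are each dominated by one of the three terms of `nwBound` (triage r1-2/r1-3 recount).
Size: M–L (needs NW1996 vendored as a Literature named fact; everything else is height
bookkeeping with `weilHeight₁_mul_le`, `exists_weilHeight₁_le_of_isAlgebraic`). No Roy machinery. -/
def LeafQuotientRigidity : Prop :=
  ∀ (ξ η : ℂ), η ≠ 0 → ∃ c : ℝ, 0 < c ∧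
    ∀ (Dg H L S : ℝ), 1 ≤ Dg → 1 ≤ H → c ≤ L → c ≤ S → LeafPair ξ η Dg H L S →
      S ≤ c * nwBound Dg H L

/-- **Stub statement 3 — the kill bookkeeping (pure real analysis).** For `1 < τ < 2 < …`, `β > τ`
there is `0 < δ₁ < δ_R` such that for every `δ ∈ (δ₁, δ_R]`, all constants `C ≥ 1`, `c > 0`, and
all large `N`: the side conditions hold and `c·nwBound(C N^{2e}, C N^{b(1+β−τ)}, N^{β+δ−τ}/C) <
N^{β+δ}/C`. Why true: at `δ = δ_R`, `e = 0` and `b(1+β−τ) = β − 1`, so the three terms have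
`N`-exponents `β−1`, `β−2+τ−δ_R`, `2τ−2−2δ_R` against `β+δ_R` — margins `1+δ_R`, `(2−τ)+2δ_R`,
`β+2−2τ+3δ_R`, all positive (checked on an 84-point grid and symbolically by triage r1-3,
Scratch2.lean); strict margins absorb `log` factors and constants and persist on `(δ₁, δ_R]` by
continuity. Size: M. The resulting `δ₁(β,τ)` is the line's new exponent (generic branch
`2.5(2−τ)(τ−1)/(2+3β−2τ)`, e.g. `(τ,β) = (1.5,2)`: `δ_R = 0.1667 ↦ δ₁ ≈ 0.125`). -/
def KillBookkeeping : Prop :=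
  ∀ (β τ : ℝ), 1 < τ → τ < 2 → τ < β →
    ∃ δ₁ : ℝ, 0 < δ₁ ∧ δ₁ < royGap β τ ∧ ∀ δ : ℝ, δ₁ < δ → δ ≤ royGap β τ →
      ∀ (C c : ℝ), 1 ≤ C → 0 < c → ∀ᶠ N : ℕ in atTop,
        1 ≤ C * (N : ℝ) ^ (2 * degExp β τ δ) ∧ 1 ≤ C * (N : ℝ) ^ htExp β τ δ ∧
        c ≤ (N : ℝ) ^ (β + δ - τ) / C ∧ c ≤ (N : ℝ) ^ (β + δ) / C ∧
        c * nwBound (C * (N : ℝ) ^ (2 * degExp β τ δ)) (C * (N : ℝ) ^ htExp β τ δ)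
            ((N : ℝ) ^ (β + δ - τ) / C) < (N : ℝ) ^ (β + δ) / C

/-- Stub 1 (hardest; Roy-internals exposure). -/
theorem stub_leafHuggingEnemies : LeafHuggingEnemies := by
  sorry

/-- Stub 2 (transcendence input: NW1996 instance + Liouville). -/
theorem stub_leafQuotientRigidity : LeafQuotientRigidity := by
  sorry

/-- Stub 3 (exponent bookkeeping). -/
theorem stub_killBookkeeping : KillBookkeeping := by
  sorry

/-- **The lever's deliverable: Roy's exponent is not sharp anywhere on `1 < τ < 2`** (identical in
shape to `Sketch.RoyExponentNotSharp` of SketchIdeator3.lean): for every `1 < τ < 2`, `β > τ` some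
`δ₁ < δ_R` already forces algebraicity for `ν > 2+β−τ+δ₁`. A `CruxAboveWindow`-type statement
(§1): strictly between `roy2013_thm_1_1` and the crux, logically invisible to the crux. -/
def RoyExponentNotSharp : Prop :=
  ∀ (β τ : ℝ), 1 < τ → τ < 2 → τ < β → ∃ δ₁ : ℝ, δ₁ < royGap β τ ∧
    ∀ (ξ η : ℂ), η ≠ 0 → ∀ ν : ℝ, 2 + β - τ + δ₁ < ν → SmallValueHyp ξ η β τ ν →
      IsAlgebraic ℚ ξ ∧ IsAlgebraic ℚ η

/-- **Composition (real proof): the three stubs give `RoyExponentNotSharp`.** Above `δ_R` use Roy's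
theorem (tree, `roy2013_thm_1_1_holds`); on `(δ₁, δ_R]` assume `(ξ,η) ∉ ℚ̄²`, take the leaf-hugging
pairs of stub 1 (frequently in `N`), bound `S` by stub 2, and contradict stub 3 (eventually in `N`). -/
theorem royExponentNotSharp_of (h₁ : LeafHuggingEnemies) (h₂ : LeafQuotientRigidity)
    (h₃ : KillBookkeeping) : RoyExponentNotSharp := by
  intro β τ hτ1 hτ2 hβ
  obtain ⟨δ₁, hδ₁0, hδ₁R, hkill⟩ := h₃ β τ hτ1 hτ2 hβ
  refine ⟨δ₁, hδ₁R, fun ξ η hη ν hν hyp => ?_⟩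
  by_contra hna
  rcases lt_or_ge (2 + β - τ + royGap β τ) ν with hR | hR
  · exact hna (roy2013_thm_1_1_holds ξ η hη β τ ν hτ1.le hτ2 hβ (by unfold royGap at hR; linarith) hyp)
  · set δ : ℝ := ν - (2 + β - τ) with hδ
    have hδ₁δ : δ₁ < δ := by rw [hδ]; linarith
    have hδR : δ ≤ royGap β τ := by rw [hδ]; linarith
    have hδ0 : 0 < δ := lt_trans hδ₁0 hδ₁δ
    have hyp' : SmallValueHyp ξ η β τ (2 + β - τ + δ) := by
      have hν' : 2 + β - τ + δ = ν := by rw [hδ]; ring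
      rw [hν']
      exact hyp
    obtain ⟨C, hC, hfreq⟩ := h₁ ξ η hη hna β τ δ hτ1 hτ2 hβ hδ0 hδR hyp'
    obtain ⟨c, hc, hrig⟩ := h₂ ξ η hη
    obtain ⟨N, hpair, hDg, hH, hL, hS, hlt⟩ :=
      (hfreq.and_eventually (hkill δ hδ₁δ hδR C c hC hc)).exists
    have hle := hrig _ _ _ _ hDg hH hL hS hpair
    linarith

/-- The skeleton instantiated on the (sorried) stubs: what a lead prover would close for the
SUPPORT statement — NOT for the crux. -/
theorem royExponentNotSharp_skeleton : RoyExponentNotSharp :=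
  royExponentNotSharp_of stub_leafHuggingEnemies stub_leafQuotientRigidity stub_killBookkeeping

/-- Sandwich, upper half: the crux implies the deliverable (with `δ₁ = 0`). -/
theorem royExponentNotSharp_of_crux (h : RoySmallValueDirichletGap) : RoyExponentNotSharp := by
  intro β τ hτ1 hτ2 hβ
  refine ⟨0, royGap_pos hτ1 hτ2 hβ, fun ξ η hη ν hν hyp => ?_⟩
  exact h ξ η hη β τ ν hτ1.le hτ2 hβ (by linarith) hyp

/-- Sandwich, lower half: the deliverable implies Roy's printed theorem on `1 < τ`
(so it sits between `roy2013_thm_1_1` and the crux). -/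
theorem print_of_royExponentNotSharp (h : RoyExponentNotSharp) (ξ η : ℂ) (hη : η ≠ 0) (β τ ν : ℝ)
    (hτ1 : 1 < τ) (hτ2 : τ < 2) (hβ : τ < β) (hν : 2 + β - τ + royGap β τ < ν)
    (hyp : SmallValueHyp ξ η β τ ν) : IsAlgebraic ℚ ξ ∧ IsAlgebraic ℚ η := by
  obtain ⟨δ₁, hδ₁, hh⟩ := h β τ hτ1 hτ2 hβ
  exact hh ξ η hη ν (by linarith) hyp

/-! ## §3 Edge budget: the lever cannot reach the Dirichlet edge for `τ ≤ 3/2` under ANY measure -/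

/-- At the edge the enemy degree exponent is `2 − τ`. -/
theorem degExp_zero {β τ : ℝ} (h2 : τ < 2) : degExp β τ 0 = 2 - τ := by
  unfold degExp
  rw [zero_mul, zero_div, sub_zero]
  exact max_eq_right (by linarith)

/-- At the edge the enemy height exponent is `1 + β − τ`. -/
theorem htExp_zero (β τ : ℝ) : htExp β τ 0 = 1 + β - τ := by
  unfold htExp
  rw [zero_div, sub_zero, one_mul]

/-- At Roy's threshold the enemy degree exponent vanishes: `e(δ_R) = 0` (near-bounded degree just
below `δ_R`, which is what makes the sub-gap window reachable). [cite: Roy2013, §7, Step 5] -/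
theorem degExp_royGap {β τ : ℝ} (h1 : 1 < τ) (hβ : τ < β) : degExp β τ (royGap β τ) = 0 := by
  unfold degExp royGap
  have hτ : τ - 1 ≠ 0 := by
    intro h; linarith
  have hb : β + 1 - τ ≠ 0 := by
    intro h; linarith
  have : (τ - 1) * (2 - τ) / (β + 1 - τ) * (1 + β - τ) / (τ - 1) = 2 - τ := by
    field_simp
    ring
  rw [this, sub_self, max_self]

/-- **Edge budget, optimal count.** Any arithmetic exclusion of the enemy quotient `(a, b)` costs at
least Liouville strength `D·h`, at best `deg Z′·h(Z) + deg Z·h(Z′) ≍ N^{e(δ)} · N^{b(δ)(1+β−τ)}`; at the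
edge (`e(0) = 2−τ`, `b(0)(1+β−τ) = 1+β−τ`, leaf-closeness `S ≍ N^{β}`) the lever's NECESSARY condition is
`(2 − τ) + (1 + β − τ) < β`, i.e. `τ > 3/2` (a degree-uniform measure costs `≳ D_K²·h` by Wirsing 1961,
which is worse: `τ ≥ 7/4`, sibling line `coset-difference-hermite-lindemann`). [folklore] -/
theorem edge_budget_iff (β τ : ℝ) : (2 - τ) + (1 + β - τ) < β ↔ 3 / 2 < τ := by
  constructor <;> intro h <;> linarith

/-- **Edge budget, crude count** `D·h ≤ deg Z·deg Z′·max(h̄) ≍ N^{2(2−τ)}·N^{1+β−τ}` (as in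
`nwBound`'s inputs `Dg`, `H`): `τ > 5/3`. [folklore] -/
theorem edge_budget_compositum_iff (β τ : ℝ) : 2 * (2 - τ) + (1 + β - τ) < β ↔ 5 / 3 < τ := by
  constructor <;> intro h <;> linarith

/-- The Liouville-strength threshold below `3/2` has Nguyen–Roy's shape: exclusion at cost `D·h` kills
at `δ` iff `e(δ) + b(δ)(1+β−τ) < β + δ`, i.e. `δ > (3−2τ)(τ−1)/(1+2β−τ)` (= `δcount` of the sibling
line's CosetDifferenceExponents.lean) — compare `(σ−1)(3−2σ)/(2+β−2σ)` in `nguyenRoy2016_thm_1`; the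
residual `1 < τ < 3/2` of this crux thus mirrors the open part of crux #4
`NguyenRoySmallValueTranslates`. Recorded as the algebraic identity behind that threshold (`τ > 1`).
[folklore] -/
theorem conditional_threshold_identity {β τ δ : ℝ} (h1 : 1 < τ) :
    (2 - τ - δ * (1 + β - τ) / (τ - 1)) + (1 - δ / (τ - 1)) * (1 + β - τ) < β + δ ↔
      (3 - 2 * τ) * (τ - 1) < δ * (1 + 2 * β - τ) := by
  have hτ : 0 < τ - 1 := by linarith
  have hτ' : τ - 1 ≠ 0 := hτ.ne'
  have key : (2 - τ - δ * (1 + β - τ) / (τ - 1)) + (1 - δ / (τ - 1)) * (1 + β - τ) =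
      β + δ - (δ * (1 + 2 * β - τ) - (3 - 2 * τ) * (τ - 1)) / (τ - 1) := by
    field_simp
    ring
  rw [key, sub_lt_self_iff, div_pos_iff_of_pos_right hτ, sub_pos]

end Summit.Schanuel.Schanuel.Cruxes.RoySmallValueDirichletGap.LeafInvariantTheta

end
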